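import Mathlib
import Summits.Ventures.PercRepro.TriangleCapRowA2Pieces
import Summits.Ventures.PercRepro.TriangleCapRowA2LastArith

/-!
# PercRepro — THE ROW `r = a + 2`: THE SIDES OF AN `a`-BIPARTITE `D − z` AND THE FINER MIXED READS AT
`d ∈ {a − 2, a − 1}` (p3, gen 48; part 201b)

`inside_deg_bound` (the mirror of `offside_deg_bound`, `K₄⁻`): an in-side neighbour of `z` is adjacent to at most
one of the off-side neighbours of `z`, so its degree in `D − z` is `≤ |A′ᶜ| + 1 − s₀`. `sides_A2_gen`: `D` is
`a`-bipartite (all neighbours of `z` on the side), or at the triple-broom target (all off the side: `rowA2_alloff`),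
or `2 ≤ d(z)` with the crude mixed bound. `rowA2_mixed_core`: with a neighbour on each side the sum `T` of the
degrees of the neighbours of `z` in `D − z` obeys one of three reads — `s₀ ≥ 2` off-side neighbours:
`T ≤ t (k − a − s₀) + s₀ (a + 1 − t)`; a single off-side neighbour `w₀` and the missing graph of `D − z` not a star:
`T ≤ t (k − a − 2) + (a + 1 − t)`; a single off-side neighbour and a missing star — its centre is `w₀` (which misses
`≥ 2` in-side neighbours of `z`), so every missing pair contains `w₀`, `d + 2 ≤ a` and `T ≤ t (k − a − 2) + (a − d − 2)`.
`rowA2_last_mixed_two` / `rowA2_last_mixed_one`: the target at `d = a − 2` / `d = a − 1` through the arithmetic of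
part 201a. Axioms: standard.
-/

namespace PercRepro

namespace TriangleCap

namespace C047

open Finset

variable {V : Type*} [Fintype V] [DecidableEq V]

/-- **THE IN-SIDE DEGREE BOUND:** `D − z ⊆ K(A′, A′ᶜ)`, `u ∈ A′` adjacent to `z` ⇒ `u` is adjacent (in `D − z`) to at
most one of the off-side neighbours of `z`: `deg (D − z) u + |N(z) ∖ A′| ≤ |A′ᶜ| + 1`. -/
theorem inside_deg_bound (D : SimpleGraph V) [DecidableRel D.Adj] (hK : K4mFree D) (z : V)
    (A' : Finset {v : V // v ≠ z}) (hB : BipSub (del D z) A') (u : {v : V // v ≠ z}) (huA : u ∈ A')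
    (huz : D.Adj u.1 z) :
    deg (del D z) u + (A'ᶜ.filter (fun w => D.Adj w.1 z)).card ≤ A'ᶜ.card + 1 := by
  -- the neighbours of `u` lie off `A′`
  have hsub : univ.filter (fun w => (del D z).Adj u w) ⊆ A'ᶜ := by
    intro w hw
    rw [mem_filter] at hw
    have := hB u w hw.2
    rw [mem_compl]
    tauto
  -- at most one of them is a neighbour of `z`
  have hone : ((univ.filter (fun w => (del D z).Adj u w)).filter (fun w => D.Adj w.1 z)).card ≤ 1 := by
    by_contra hcon
    push Not at hcon
    obtain ⟨w₁, hw₁, w₂, hw₂, hne⟩ := one_lt_card.mp hcon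
    rw [mem_filter, mem_filter] at hw₁ hw₂
    exact not_adj_both D hK (D.adj_symm huz) (D.adj_symm hw₁.2) ((del_adj D z u w₁).mp hw₁.1.2)
      (fun h => hne (Subtype.ext h)) (D.adj_symm hw₂.2) ((del_adj D z u w₂).mp hw₂.1.2)
  have hsplit := card_filter_add_card_filter_not (s := univ.filter (fun w => (del D z).Adj u w))
    (fun w => D.Adj w.1 z)
  have hoff : ((univ.filter (fun w => (del D z).Adj u w)).filter (fun w => ¬ D.Adj w.1 z)).card ≤
      (A'ᶜ.filter (fun w => ¬ D.Adj w.1 z)).card :=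
    card_le_card (fun w hw => by rw [mem_filter] at hw ⊢; exact ⟨hsub hw.1, hw.2⟩)
  have hA := card_filter_add_card_filter_not (s := A'ᶜ) (fun w => D.Adj w.1 z)
  unfold deg
  omega

/-- **THE SIDES OF AN `a`-BIPARTITE `D − z` ON THE CELL `(k, a, a + 2)`, `5 ≤ a`, `3a + 2 ≤ k`:** `D` is
`a`-bipartite, or at the triple-broom target (all neighbours of `z` off the side: `rowA2_alloff`), or `2 ≤ d(z)`, a
neighbour of `z` lies off the `a`-side and `T + (k − a − 2) ≤ d(z)(k − a − 2) + a`. -/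
theorem sides_A2_gen (D : SimpleGraph V) [DecidableRel D.Adj] (a : ℕ) (ha5 : 5 ≤ a)
    (hk : 3 * a + 2 ≤ Fintype.card V) (hm : D.edgeFinset.card + (a + 2) = a * (Fintype.card V - a)) (z : V)
    (hz : deg D z + 1 ≤ a) (A' : Finset {v : V // v ≠ z}) (hA'card : A'.card = a) (hB : BipSub (del D z) A')
    (hm' : (del D z).edgeFinset.card + (deg D z + 2) = a * (Fintype.card {v : V // v ≠ z} - a))
    (hcap : ∀ v, deg D v ≤ (Fintype.card V - a - 2) + 1) :
    (∃ A : Finset V, A.card = a ∧ BipSub D A) ∨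
      (∑ v, deg D v * deg D v + (a + 2) * (Fintype.card V - 1 - (a + 2)) + (2 * Fintype.card V + 2 * a - 14) ≤
        D.edgeFinset.card * Fintype.card V) ∨
      (2 ≤ deg D z ∧
        ∑ w : {v : V // v ≠ z}, (if D.Adj w.1 z then deg (del D z) w else 0) + (Fintype.card V - a - 2) ≤
          deg D z * (Fintype.card V - a - 2) + a) := by
  by_cases hall : ∀ w : {v : V // v ≠ z}, D.Adj w.1 z → w ∈ A'
  · obtain ⟨B, hBcard, hBsub⟩ := bipSub_lift D z A' hB hall
    exact Or.inl ⟨B, by rw [hBcard, hA'card], hBsub⟩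
  by_cases hnone : ∀ w : {v : V // v ≠ z}, D.Adj w.1 z → w ∉ A'
  · right; left
    push Not at hall
    obtain ⟨w₀, hw₀z, _⟩ := hall
    exact rowA2_alloff D a ha5 hk hm z hz A' hA'card hB hm' hnone w₀ hw₀z
  · right; right
    push Not at hall hnone
    obtain ⟨w₀, hw₀z, hw₀A⟩ := hall
    obtain ⟨w₁, hw₁z, hw₁A⟩ := hnone
    have hne : w₀ ≠ w₁ := fun h => hw₀A (h ▸ hw₁A)
    obtain ⟨Nz, hNzdef⟩ : ∃ Nz : Finset {v : V // v ≠ z},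
        Nz = univ.filter (fun w : {v : V // v ≠ z} => D.Adj w.1 z) := ⟨_, rfl⟩
    have hmemNz : ∀ w : {v : V // v ≠ z}, w ∈ Nz ↔ D.Adj w.1 z := fun w => by
      rw [hNzdef, mem_filter]
      simp only [mem_univ, true_and]
    have hNz : Nz.card = deg D z := by rw [hNzdef]; exact card_nbhd_del D z
    refine ⟨?_, ?_⟩
    · have hsub : ({w₀, w₁} : Finset {v : V // v ≠ z}) ⊆ Nz := by
        intro w hw
        rw [mem_insert, mem_singleton] at hw
        rcases hw with rfl | rfl
        · exact (hmemNz _).mpr hw₀z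
        · exact (hmemNz _).mpr hw₁z
      have := card_le_card hsub
      rw [card_pair hne] at this
      omega
    · have hTfilt : ∑ w : {v : V // v ≠ z}, (if D.Adj w.1 z then deg (del D z) w else 0) =
          ∑ w ∈ Nz, deg (del D z) w := by
        rw [hNzdef, sum_filter]
      rw [hTfilt, ← hNz]
      have hdw₀ : deg (del D z) w₀ ≤ a := by
        have := deg_le_card_of_bipSub (del D z) A' hB w₀ hw₀A
        rw [hA'card] at this
        exact this
      exact sum_le_of_mem_le_gen Nz (fun w => deg (del D z) w) (Fintype.card V - a - 2) a ((hmemNz w₀).mpr hw₀z)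
        (fun w hw => by
          have h := deg_del D z w
          rw [if_pos ((hmemNz w).mp hw)] at h
          have := hcap w.1
          omega) hdw₀

/-- **THE CORE OF THE MIXED READ** (`D − z ⊆ K(A′, A′ᶜ)`, `|A′| = a`, `d(z) ≥ 4`, a neighbour `w₀` of `z` off the
side and a neighbour `w₁` on it, no vertex at the cap): with `t` in-side and `s₀` off-side neighbours of `z`,
`T = Σ_{w ∼ z} deg (D − z) w` obeys one of: `s₀ ≥ 2` and `T ≤ t (k − a − s₀) + s₀ (a + 1 − t)`; `s₀ = 1`, the missing
graph of `D − z` is not a star and `T ≤ t (k − a − 2) + (a + 1 − t)`; `s₀ = 1`, `d(z) + 2 ≤ a` and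
`T ≤ t (k − a − 2) + (a − (d(z) + 2))` (the missing graph is a star at `w₀`, which misses `d(z) + 2` vertices of `A′`). -/
theorem rowA2_mixed_core (D : SimpleGraph V) [DecidableRel D.Adj] (hK : K4mFree D) (a : ℕ)
    (hk : 3 * a + 2 ≤ Fintype.card V) (z : V) (hd4 : 4 ≤ deg D z) (A' : Finset {v : V // v ≠ z}) (hA'card : A'.card = a) (hB : BipSub (del D z) A')
    (hm' : (del D z).edgeFinset.card + (deg D z + 2) = a * (Fintype.card {v : V // v ≠ z} - a))
    (hcap : ∀ v, deg D v ≤ (Fintype.card V - a - 2) + 1) (w₀ : {v : V // v ≠ z}) (hw₀A : w₀ ∉ A')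
    (hw₀z : D.Adj w₀.1 z) (w₁ : {v : V // v ≠ z}) (hw₁A : w₁ ∈ A') (hw₁z : D.Adj w₁.1 z) :
    ∃ t s₀, t + s₀ = deg D z ∧ 1 ≤ t ∧ 1 ≤ s₀ ∧
      ((2 ≤ s₀ ∧ ∑ w : {v : V // v ≠ z}, (if D.Adj w.1 z then deg (del D z) w else 0) ≤
          t * (Fintype.card V - a - s₀) + s₀ * (a + 1 - t)) ∨
       (s₀ = 1 ∧ (¬ ∃ v, MissingStar (del D z) A' v) ∧
          ∑ w : {v : V // v ≠ z}, (if D.Adj w.1 z then deg (del D z) w else 0) ≤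
            t * (Fintype.card V - a - 2) + (a + 1 - t)) ∨
       (s₀ = 1 ∧ deg D z + 2 ≤ a ∧
          ∑ w : {v : V // v ≠ z}, (if D.Adj w.1 z then deg (del D z) w else 0) ≤
            t * (Fintype.card V - a - 2) + (a - (deg D z + 2)))) := by
  have hcard' := card_del z
  obtain ⟨Nz, hNzdef⟩ : ∃ Nz : Finset {v : V // v ≠ z},
      Nz = univ.filter (fun w : {v : V // v ≠ z} => D.Adj w.1 z) := ⟨_, rfl⟩
  have hmemNz : ∀ w : {v : V // v ≠ z}, w ∈ Nz ↔ D.Adj w.1 z := fun w => by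
    rw [hNzdef, mem_filter]
    simp only [mem_univ, true_and]
  have hNz : Nz.card = deg D z := by rw [hNzdef]; exact card_nbhd_del D z
  have hTfilt : ∑ w : {v : V // v ≠ z}, (if D.Adj w.1 z then deg (del D z) w else 0) =
      ∑ w ∈ Nz, deg (del D z) w := by
    rw [hNzdef, sum_filter]
  rw [hTfilt]
  have hdegNz : ∀ w ∈ Nz, deg (del D z) w + 1 ≤ Fintype.card V - a - 1 := fun w hw => by
    have h := deg_del D z w
    rw [if_pos ((hmemNz w).mp hw)] at h
    have := hcap w.1
    omega
  -- the in-side and off-side neighbours of `z`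
  obtain ⟨I, hI⟩ : ∃ I : Finset {v : V // v ≠ z}, I = Nz.filter (fun w => w ∈ A') := ⟨_, rfl⟩
  obtain ⟨O, hO⟩ : ∃ O : Finset {v : V // v ≠ z}, O = Nz.filter (fun w => w ∉ A') := ⟨_, rfl⟩
  have hIO : I.card + O.card = deg D z := by
    rw [hI, hO, card_filter_add_card_filter_not, hNz]
  have hIeq : I = A'.filter (fun w => D.Adj w.1 z) := by
    rw [hI]
    ext w
    rw [mem_filter, mem_filter, hmemNz]
    tauto
  have hOeq : O = A'ᶜ.filter (fun w => D.Adj w.1 z) := by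
    rw [hO]
    ext w
    rw [mem_filter, mem_filter, hmemNz, mem_compl]
    tauto
  have hTsplit : ∑ w ∈ Nz, deg (del D z) w = ∑ w ∈ I, deg (del D z) w + ∑ w ∈ O, deg (del D z) w := by
    rw [hI, hO, sum_filter_add_sum_filter_not]
  have hTI : ∑ w ∈ I, deg (del D z) w ≤ I.card * (Fintype.card V - a - 2) := by
    rw [← smul_eq_mul, ← sum_const]
    apply sum_le_sum
    intro w hw
    have := hdegNz w (mem_of_mem_filter w (hI ▸ hw))
    omega
  have hoff : ∀ w ∈ O, deg (del D z) w + I.card ≤ a + 1 := fun w hw => by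
    rw [hO, mem_filter, hmemNz] at hw
    have h := offside_deg_bound D hK z A' hB w hw.2 hw.1
    rw [← hIeq, hA'card] at h
    exact h
  have hTO : ∑ w ∈ O, deg (del D z) w ≤ O.card * (a + 1 - I.card) := by
    rw [← smul_eq_mul, ← sum_const]
    apply sum_le_sum
    intro w hw
    have := hoff w hw
    omega
  have hw₀O : w₀ ∈ O := by rw [hO, mem_filter, hmemNz]; exact ⟨hw₀z, hw₀A⟩
  have hw₁I : w₁ ∈ I := by rw [hI, mem_filter, hmemNz]; exact ⟨hw₁z, hw₁A⟩
  have hO1 : 1 ≤ O.card := card_pos.mpr ⟨w₀, hw₀O⟩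
  have hI1 : 1 ≤ I.card := card_pos.mpr ⟨w₁, hw₁I⟩
  refine ⟨I.card, O.card, hIO, hI1, hO1, ?_⟩
  rcases Nat.lt_or_ge O.card 2 with hO2 | hO2
  · -- a single off-side neighbour
    have hOcard : O.card = 1 := by omega
    have hOeq' : O = {w₀} := by
      apply (eq_singleton_iff_unique_mem).mpr ⟨hw₀O, fun w hw => ?_⟩
      exact card_le_one.mp (by omega : O.card ≤ 1) w hw w₀ hw₀O
    have hTO' : ∑ w ∈ O, deg (del D z) w = deg (del D z) w₀ := by rw [hOeq', sum_singleton]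
    have hdw₀ : deg (del D z) w₀ + I.card ≤ a + 1 := hoff w₀ hw₀O
    by_cases hstar : ∃ v, MissingStar (del D z) A' v
    · -- THE STAR CASE: `w₀` misses two in-side neighbours of `z`, so it is the centre
      right; right
      obtain ⟨v, hv⟩ := hstar
      have hone : (I.filter (fun w => (del D z).Adj w₀ w)).card ≤ 1 := by
        by_contra hcon
        push Not at hcon
        obtain ⟨x₁, hx₁, x₂, hx₂, hne⟩ := one_lt_card.mp hcon
        rw [mem_filter] at hx₁ hx₂
        have hx₁z := (hmemNz x₁).mp (mem_of_mem_filter x₁ (hI ▸ hx₁.1))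
        have hx₂z := (hmemNz x₂).mp (mem_of_mem_filter x₂ (hI ▸ hx₂.1))
        exact not_adj_both D hK (D.adj_symm hw₀z) (D.adj_symm hx₁z) ((del_adj D z w₀ x₁).mp hx₁.2)
          (fun h => hne (Subtype.ext h)) (D.adj_symm hx₂z) ((del_adj D z w₀ x₂).mp hx₂.2)
      have htwo : 1 < (I.filter (fun w => ¬ (del D z).Adj w₀ w)).card := by
        have := card_filter_add_card_filter_not (s := I) (fun w => (del D z).Adj w₀ w)
        omega
      obtain ⟨x₁, hx₁, x₂, hx₂, hne⟩ := one_lt_card.mp htwo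
      rw [mem_filter] at hx₁ hx₂
      have hx₁A : x₁ ∈ A' := (mem_filter.mp (hI ▸ hx₁.1)).2
      have hx₂A : x₂ ∈ A' := (mem_filter.mp (hI ▸ hx₂.1)).2
      have hvw₀ : v = w₀ := by
        have h1 := hv x₁ w₀ hx₁A hw₀A (fun h => hx₁.2 ((del D z).adj_symm h))
        have h2 := hv x₂ w₀ hx₂A hw₀A (fun h => hx₂.2 ((del D z).adj_symm h))
        rcases h1 with h1 | h1
        · rcases h2 with h2 | h2
          · exact absurd (h1.trans h2.symm) hne
          · exact h2.symm
        · exact h1.symm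
      subst hvw₀
      -- every missing edge contains `w₀`: its missing degree is `d + 2`
      have hall : ∀ e ∈ (missingGraph (del D z) A').edgeFinset, v ∈ e := by
        intro e he
        revert he
        refine Sym2.ind (fun x y he => ?_) e
        rw [SimpleGraph.mem_edgeFinset, SimpleGraph.mem_edgeSet, missingGraph_adj] at he
        rw [Sym2.mem_iff]
        by_cases hxA : x ∈ A'
        · have hyA : y ∉ A' := he.1.mp hxA
          rcases hv x y hxA hyA he.2 with h | h
          · exact absurd h (fun h => hw₀A (h ▸ hxA))
          · exact Or.inr h.symm
        · have hyA : y ∈ A' := by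
            by_contra hyA
            exact hxA (he.1.mpr hyA)
          rcases hv y x hyA hxA (fun h => he.2 ((del D z).adj_symm h)) with h | h
          · exact absurd h (fun h => hw₀A (h ▸ hyA))
          · exact Or.inl h.symm
      have hdegm := deg_eq_card_edges_of_forall (missingGraph (del D z) A') v hall
      rw [card_edges_missingGraph (del D z) A' hB a (deg D z + 2) hA'card hm'] at hdegm
      have hsum := deg_add_deg_missingGraph (del D z) A' hB v
      rw [if_neg hw₀A, hA'card, hdegm] at hsum
      refine ⟨hOcard, by omega, ?_⟩
      rw [hTsplit, hTO']
      have : deg (del D z) v = a - (deg D z + 2) := by omega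
      omega
    · -- THE NON-STAR CASE
      right; left
      refine ⟨hOcard, hstar, ?_⟩
      rw [hTsplit, hTO']
      omega
  · -- `≥ 2` off-side neighbours: each in-side neighbour at `≤ k − a − s₀`, each off-side one at `≤ a + 1 − t`
    left
    refine ⟨hO2, ?_⟩
    have hin : ∀ u ∈ I, deg (del D z) u + O.card ≤ (Fintype.card V - a - 1) + 1 := fun u hu => by
      rw [hI, mem_filter, hmemNz] at hu
      have h := inside_deg_bound D hK z A' hB u hu.2 hu.1
      rw [← hOeq, card_compl, hA'card] at h
      have : Fintype.card {v : V // v ≠ z} - a = Fintype.card V - a - 1 := by omega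
      rw [this] at h
      exact h
    have hTI' : ∑ w ∈ I, deg (del D z) w ≤ I.card * (Fintype.card V - a - O.card) := by
      rw [← smul_eq_mul, ← sum_const]
      apply sum_le_sum
      intro w hw
      have := hin w hw
      omega
    rw [hTsplit]
    omega

/-- **THE MIXED READ AT `d = a − 2` ON `(k, a, a + 2)`, `6 ≤ a`, `3a + 2 ≤ k`:** `D − z ⊆ K(A′, A′ᶜ)` with `a`
missing pairs, a neighbour of `z` off the side and one on it ⇒ the triple-broom target. -/
theorem rowA2_last_mixed_two (D : SimpleGraph V) [DecidableRel D.Adj] (hK : K4mFree D) (a : ℕ) (ha6 : 6 ≤ a)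
    (hk : 3 * a + 2 ≤ Fintype.card V) (hm : D.edgeFinset.card + (a + 2) = a * (Fintype.card V - a)) (z : V)
    (hz : deg D z = a - 2) (A' : Finset {v : V // v ≠ z}) (hA'card : A'.card = a) (hB : BipSub (del D z) A')
    (hm' : (del D z).edgeFinset.card + (deg D z + 2) = a * (Fintype.card {v : V // v ≠ z} - a))
    (hcap : ∀ v, deg D v ≤ (Fintype.card V - a - 2) + 1) (w₀ : {v : V // v ≠ z}) (hw₀A : w₀ ∉ A')
    (hw₀z : D.Adj w₀.1 z) (w₁ : {v : V // v ≠ z}) (hw₁A : w₁ ∈ A') (hw₁z : D.Adj w₁.1 z) :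
    ∑ v, deg D v * deg D v + (a + 2) * (Fintype.card V - 1 - (a + 2)) + (2 * Fintype.card V + 2 * a - 14) ≤
      D.edgeFinset.card * Fintype.card V := by
  have hcard' := card_del z
  have hedges' := card_edges_del D z
  have hsq := sum_deg_sq_del D z
  obtain ⟨t, s₀, hts, ht1, hs₀1, hcases⟩ :=
    rowA2_mixed_core D hK a hk z (by omega) A' hA'card hB hm' hcap w₀ hw₀A hw₀z w₁ hw₁A hw₁z
  obtain ⟨T, hTdef⟩ : ∃ T, ∑ w : {v : V // v ≠ z}, (if D.Adj w.1 z then deg (del D z) w else 0) = T := ⟨_, rfl⟩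
  obtain ⟨S', hS'def⟩ : ∃ S', ∑ w : {v : V // v ≠ z}, deg (del D z) w * deg (del D z) w = S' := ⟨_, rfl⟩
  obtain ⟨m', hm'def⟩ : ∃ m', (del D z).edgeFinset.card = m' := ⟨_, rfl⟩
  rw [hTdef, hS'def] at hsq
  rw [hTdef] at hcases
  rw [hm'def] at hedges'
  have hcardV' : Fintype.card {v : V // v ≠ z} = Fintype.card V - 1 := by omega
  have hmd : m' + (a - 2) + (a + 2) = a * (Fintype.card V - a) := by omega
  have hm'a : (del D z).edgeFinset.card + a = a * (Fintype.card {v : V // v ≠ z} - a) := by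
    have h := hm'
    rw [hz] at h
    have e : a - 2 + 2 = a := by omega
    rw [e] at h
    exact h
  rw [hsq, ← hedges', hz]
  rcases hcases with ⟨hs₀2, hT⟩ | ⟨hs₀, hstar, hT⟩ | ⟨hs₀, hda, hT⟩
  · have hS := sum_deg_sq_le_of_bipSub (del D z) A' hB a a hA'card hm'a (by omega)
    rw [hS'def, hm'def, hcardV'] at hS
    exact rowA2_two_mixed_ref a t s₀ (Fintype.card V) m' S' T ha6 hk (by omega) hs₀2 ht1 hmd hS hT
  · have hS := closed_form_stability_bipSub (del D z) A' hB a a hA'card hm'a (by omega) (by omega) hstar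
    rw [hS'def, hm'def, hcardV'] at hS
    have ht : t = a - 3 := by omega
    rw [ht] at hT
    have e : a + 1 - (a - 3) = 4 := by omega
    rw [e] at hT
    exact rowA2_two_nonstar a (Fintype.card V) m' S' T ha6 hk hmd hS hT
  · have hS := sum_deg_sq_le_of_bipSub (del D z) A' hB a a hA'card hm'a (by omega)
    rw [hS'def, hm'def, hcardV'] at hS
    have ht : t = a - 3 := by omega
    rw [ht, hz] at hT
    have e : a - (a - 2 + 2) = 0 := by omega
    rw [e, add_zero] at hT
    exact rowA2_two_star0 a (Fintype.card V) m' S' T ha6 hk hmd hS hT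

/-- **THE MIXED READ AT `d = a − 1` ON `(k, a, a + 2)`, `6 ≤ a`, `3a + 2 ≤ k`:** `D − z ⊆ K(A′, A′ᶜ)` with `a + 1`
missing pairs, a neighbour of `z` off the side and one on it ⇒ the triple-broom target (the missing star is impossible:
its centre would miss `a + 1` vertices of `A′`). -/
theorem rowA2_last_mixed_one (D : SimpleGraph V) [DecidableRel D.Adj] (hK : K4mFree D) (a : ℕ) (ha6 : 6 ≤ a)
    (hk : 3 * a + 2 ≤ Fintype.card V) (hm : D.edgeFinset.card + (a + 2) = a * (Fintype.card V - a)) (z : V)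
    (hz : deg D z = a - 1) (A' : Finset {v : V // v ≠ z}) (hA'card : A'.card = a) (hB : BipSub (del D z) A')
    (hm' : (del D z).edgeFinset.card + (deg D z + 2) = a * (Fintype.card {v : V // v ≠ z} - a))
    (hcap : ∀ v, deg D v ≤ (Fintype.card V - a - 2) + 1) (w₀ : {v : V // v ≠ z}) (hw₀A : w₀ ∉ A')
    (hw₀z : D.Adj w₀.1 z) (w₁ : {v : V // v ≠ z}) (hw₁A : w₁ ∈ A') (hw₁z : D.Adj w₁.1 z) :
    ∑ v, deg D v * deg D v + (a + 2) * (Fintype.card V - 1 - (a + 2)) + (2 * Fintype.card V + 2 * a - 14) ≤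
      D.edgeFinset.card * Fintype.card V := by
  have hcard' := card_del z
  have hedges' := card_edges_del D z
  have hsq := sum_deg_sq_del D z
  obtain ⟨t, s₀, hts, ht1, hs₀1, hcases⟩ :=
    rowA2_mixed_core D hK a hk z (by omega) A' hA'card hB hm' hcap w₀ hw₀A hw₀z w₁ hw₁A hw₁z
  obtain ⟨T, hTdef⟩ : ∃ T, ∑ w : {v : V // v ≠ z}, (if D.Adj w.1 z then deg (del D z) w else 0) = T := ⟨_, rfl⟩
  obtain ⟨S', hS'def⟩ : ∃ S', ∑ w : {v : V // v ≠ z}, deg (del D z) w * deg (del D z) w = S' := ⟨_, rfl⟩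
  obtain ⟨m', hm'def⟩ : ∃ m', (del D z).edgeFinset.card = m' := ⟨_, rfl⟩
  rw [hTdef, hS'def] at hsq
  rw [hTdef] at hcases
  rw [hm'def] at hedges'
  have hcardV' : Fintype.card {v : V // v ≠ z} = Fintype.card V - 1 := by omega
  have hmd : m' + (a - 1) + (a + 2) = a * (Fintype.card V - a) := by omega
  have hm'a : (del D z).edgeFinset.card + (a + 1) = a * (Fintype.card {v : V // v ≠ z} - a) := by
    have h := hm'
    rw [hz] at h
    have e : a - 1 + 2 = a + 1 := by omega
    rw [e] at h
    exact h
  rw [hsq, ← hedges', hz]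
  rcases hcases with ⟨hs₀2, hT⟩ | ⟨hs₀, hstar, hT⟩ | ⟨_, hda, _⟩
  · have hS := sum_deg_sq_le_of_bipSub (del D z) A' hB a (a + 1) hA'card hm'a (by omega)
    rw [hS'def, hm'def, hcardV'] at hS
    exact rowA2_one_mixed_ref a t s₀ (Fintype.card V) m' S' T ha6 hk (by omega) hs₀2 ht1 hmd hS hT
  · have hS := closed_form_stability_bipSub (del D z) A' hB a (a + 1) hA'card hm'a (by omega) (by omega) hstar
    rw [hS'def, hm'def, hcardV'] at hS
    have ht : t = a - 2 := by omega
    rw [ht] at hT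
    have e : a + 1 - (a - 2) = 3 := by omega
    have e2 : a + 1 - 2 = a - 1 := by omega
    rw [e] at hT
    rw [e2] at hS
    exact rowA2_one_nonstar a (Fintype.card V) m' S' T ha6 hk hmd hS hT
  · exfalso
    omega

end C047

end TriangleCap

end PercRepro
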